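import Summits.QuantumFields.YangMills.Theorems.FlatTubeReductionDressedWeightOfDiagonal
import HarnessLib

/-!
# The dressed weight of a NORMALISED profile: the clamp of the quotient `f̂/m` of two physical near-`1` families — the five `W`-fields of `RateTube.AnalyticRatePotInput` for
# `W̃ = clampW κ (f̂/m) (min(d_tor,½))` with `κ = 2(κ₀ + κ_N)` and slack `2(ε_W + ε_N)`
# (route `FlatTubeReduction`, crux K1 `NearFlatRatioLaw` stmt-QuantumFields-24720; seat `ym-line-ftr-p1` g14; rate twin «ratepack-v3 / frozen fibres»; R2b1 RECORD rung — no summit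
# statement is proved here)

WHY (memo `Cruxes/NearFlatRatioLaw/Lines/ratepack-v3-frozen-g12.md` §8).  The (B-N) brick at rate holds exactly only for the NORMALISED profile `Ω_u = Ω/√m(u)`,
`m(u) = mass(u)/mass(1)` (`…ProfileNormalisation.fibreMassAd_normalise`); the kernel side then sees the amplitude `φ/√m` (`boFunAd_scale`), so the dressing becomes `W̃/√m`, i.e. the
clamp of the quotient family `f̂/m`.  Given the exact-dressing estimate `|f̂ − 1| ≤ κ₀d² + ε_W` (F8, `…ExactDressing`) and the FUTURE brick F9 ((N) pointwise at rate:
`|m − 1| ≤ κ_N d² + ε_N` on the window, `m` extended to a physical = gauge- and twist-invariant function off the window), elementary algebra gives `|f̂/m − 1| ≤ 2(κ₀+κ_N)d² + 2(ε_W+ε_N)`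
once `κ_Nδ₁² + ε_N ≤ ½`, and `dressedWeight_fields` applies verbatim.
* `abs_div_sub_one_le_two_mul` (the algebra), ★★ `dressedWeight_fields_normalised`.
HONEST FRAMING: real-analysis bookkeeping; INPUTS are F8 (landed, unconditional for core-supported profiles) and F9 (open); femto rung R2b1 (RECORD label); not infinite volume, not a gap,
not Clay.  No defs, no named facts, no `sorry`.
-/

set_option autoImplicit false

noncomputable section

open MeasureTheory Filter Topology Real
open scoped BigOperators
open Literature.MathematicalPhysics.QuantumFieldTheory
open Literature.MathematicalPhysics.QuantumLattice

namespace Summit.QuantumFields.YangMills.Theorems.FemtoTransferGap.RateTube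

open Summit.QuantumFields.YangMills.Theorems.FemtoTransferGap

/-- The algebra of the quotient: `|f − 1| ≤ a`, `|m − 1| ≤ b ≤ ½` ⇒ `0 < m`, and `|f/m − 1| ≤ 2(a + b)`; also `0 ≤ f → 0 ≤ f/m`. [folklore] -/
theorem abs_div_sub_one_le_two_mul {f m a b : ℝ} (hf : |f - 1| ≤ a) (hm : |m - 1| ≤ b) (hb : b ≤ 1 / 2) : 0 < m ∧ |f / m - 1| ≤ 2 * (a + b) := by
  obtain ⟨hm1, hm2⟩ := abs_le.mp hm
  obtain ⟨hf1, hf2⟩ := abs_le.mp hf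
  have hmpos : 1 / 2 ≤ m := by linarith
  have hm0 : 0 < m := by linarith
  refine ⟨hm0, ?_⟩
  have e : f / m - 1 = (f - m) / m := by field_simp
  rw [e, abs_div, abs_of_pos hm0, div_le_iff₀ hm0]
  have hfm : |f - m| ≤ a + b := by
    rw [show f - m = (f - 1) - (m - 1) by ring]
    exact (abs_sub _ _).trans (by linarith)
  have ha0 : 0 ≤ a + b := (abs_nonneg _).trans hfm
  nlinarith

variable {L : ℕ} [NeZero L]

/-- ★★ **THE DRESSED-WEIGHT FIELDS FOR A QUOTIENT OF NEAR-`1` FAMILIES.**  `f̂, m : ℝ → (one-site configs) → ℝ`, each measurable, gauge and twist invariant for every `β`; window radius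
`δ₁ ≤ ½` eventually; on the window eventually `0 ≤ f̂` with `|f̂ − 1| ≤ κ₀·orbitDist² + ε_W` and `|m − 1| ≤ κ_N·orbitDist² + ε_N`, with `κ_N ≥ 0`, `0 ≤ ε_W, ε_N` and `κ_Nδ₁² + ε_N ≤ ½`
eventually.  Then for every `κ ≥ max(2(κ₀+κ_N), 0)` the weight `W̃ β := clampW κ (f̂ β/m β) (min(d_tor,½))` has: `IsPhys (W̃ β)`, `0 ≤ W̃`, `|W̃| ≤ √(1+κ/4)`,
`orbitDist u < δ₁ β → |W̃ β u² − 1| ≤ κ·orbitDist u²` (all `β`, `u`), and eventually on the window `|W̃ β u² − f̂ β u/m β u| ≤ 2(ε_W β + ε_N β)`. [folklore] -/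
theorem dressedWeight_fields_normalised {f m : ℝ → GaugeConfig 3 1 SU2 → ℝ} (hfm : ∀ β, Measurable (f β))
    (hfg : ∀ β (g : Site 3 1 → SU2) (u : GaugeConfig 3 1 SU2), f β (gaugeTransform g u) = f β u)
    (hft : ∀ β (k : Fin 3), ∀ z ∈ Subgroup.center SU2, ∀ u : GaugeConfig 3 1 SU2, f β (twist k z u) = f β u)
    (hmm : ∀ β, Measurable (m β)) (hmg : ∀ β (g : Site 3 1 → SU2) (u : GaugeConfig 3 1 SU2), m β (gaugeTransform g u) = m β u)
    (hmt : ∀ β (k : Fin 3), ∀ z ∈ Subgroup.center SU2, ∀ u : GaugeConfig 3 1 SU2, m β (twist k z u) = m β u)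
    {δ₁ εW εN : ℝ → ℝ} {κ₀ κN κ : ℝ} (hκκ : 2 * (κ₀ + κN) ≤ κ) (hκ : 0 ≤ κ) (hκN : 0 ≤ κN) (hδ : ∀ᶠ β in atTop, δ₁ β ≤ 1 / 2)
    (hε : ∀ᶠ β in atTop, 0 ≤ εW β) (hεN : ∀ᶠ β in atTop, 0 ≤ εN β) (hsmall : ∀ᶠ β in atTop, κN * δ₁ β ^ 2 + εN β ≤ 1 / 2)
    (hnear : ∀ᶠ β in atTop, ∀ u : GaugeConfig 3 1 SU2, orbitDist u < δ₁ β → 0 ≤ f β u ∧ |f β u - 1| ≤ κ₀ * orbitDist u ^ 2 + εW β)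
    (hmnear : ∀ᶠ β in atTop, ∀ u : GaugeConfig 3 1 SU2, orbitDist u < δ₁ β → |m β u - 1| ≤ κN * orbitDist u ^ 2 + εN β) :
    (∀ β, IsPhys (clampW κ (fun u => f β u / m β u) (fun U : GaugeConfig 3 1 SU2 => min (torDist U) (1 / 2)))) ∧
    (∀ β u, 0 ≤ clampW κ (fun u => f β u / m β u) (fun U : GaugeConfig 3 1 SU2 => min (torDist U) (1 / 2)) u) ∧
    (∀ β u, |clampW κ (fun u => f β u / m β u) (fun U : GaugeConfig 3 1 SU2 => min (torDist U) (1 / 2)) u| ≤ Real.sqrt (1 + κ / 4)) ∧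
    (∀ β u, orbitDist u < δ₁ β → |clampW κ (fun u => f β u / m β u) (fun U : GaugeConfig 3 1 SU2 => min (torDist U) (1 / 2)) u ^ 2 - 1| ≤ κ * orbitDist u ^ 2) ∧
    (∀ᶠ β in atTop, ∀ u : GaugeConfig 3 1 SU2, orbitDist u < δ₁ β →
      |clampW κ (fun u => f β u / m β u) (fun U : GaugeConfig 3 1 SU2 => min (torDist U) (1 / 2)) u ^ 2 - f β u / m β u| ≤ 2 * (εW β + εN β)) := by
  have hqm : ∀ β, Measurable (fun u => f β u / m β u) := fun β => (hfm β).div (hmm β)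
  have hqg : ∀ β (g : Site 3 1 → SU2) (u : GaugeConfig 3 1 SU2), f β (gaugeTransform g u) / m β (gaugeTransform g u) = f β u / m β u := fun β g u => by
    rw [hfg, hmg]
  have hqt : ∀ β (k : Fin 3), ∀ z ∈ Subgroup.center SU2, ∀ u : GaugeConfig 3 1 SU2, f β (twist k z u) / m β (twist k z u) = f β u / m β u := fun β k z hz u => by
    rw [hft β k z hz, hmt β k z hz]
  have hnear' : ∀ᶠ β in atTop, ∀ u : GaugeConfig 3 1 SU2, orbitDist u < δ₁ β →
      0 ≤ f β u / m β u ∧ |f β u / m β u - 1| ≤ 2 * (κ₀ + κN) * orbitDist u ^ 2 + 2 * (εW β + εN β) := by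
    filter_upwards [hnear, hmnear, hsmall, hδ] with β hn hmn hs hδβ u hu
    obtain ⟨hf0, hf⟩ := hn u hu
    have hm := hmn u hu
    have hd0 : 0 ≤ orbitDist u := orbitDist_nonneg u
    have hd : orbitDist u ^ 2 ≤ δ₁ β ^ 2 := pow_le_pow_left₀ hd0 hu.le 2
    have hb : κN * orbitDist u ^ 2 + εN β ≤ 1 / 2 := by nlinarith [mul_le_mul_of_nonneg_left hd hκN]
    obtain ⟨hm0, hq⟩ := abs_div_sub_one_le_two_mul hf hm hb
    refine ⟨div_nonneg hf0 hm0.le, hq.trans (le_of_eq ?_)⟩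
    ring
  have hε2 : ∀ᶠ β in atTop, 0 ≤ 2 * (εW β + εN β) := by filter_upwards [hε, hεN] with β h1 h2; positivity
  exact dressedWeight_fields (f := fun β u => f β u / m β u) hqm hqg hqt hκκ hκ hδ hε2 hnear'

end Summit.QuantumFields.YangMills.Theorems.FemtoTransferGap.RateTube

end
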